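import Summits.QuantumFields.YangMills.Theses.ParabolicTrajectory

/-!
# `BalabanStepParabolic` — negative-side support IX: species generality is illusory (curvature-only reduction)

Support file for crux `stmt-QuantumFields-9684` (`ParabolicTrajectory.BalabanStepParabolic`), extracted from the
standing disprover's work file `Cruxes/BalabanStepParabolic/Disproof.lean` §S (cycle 2). Tree objects only.

The structure `BalabanBanachStep` lets the unit-scale normalisations `c g s` be ANY real numbers off the curvature
species (`c_curvature` pins only `c g r.curvature = 1`). `cInd r` (= `1` on `r.curvature`, `0` elsewhere),
`wilsonCentredSchwinger_cInd(_of_exists)`: with `cInd` every species string that is not pure curvature has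
identically vanishing centred Wilson `n`-point functions. `curvatureOnly S` / **`exists_curvatureOnly`**: if
`BalabanBanachStep G r M` is inhabited, it is inhabited by a structure with `c g s = 0` for all `s ≠ r.curvature`
and realisation functional ZERO on every non-pure-curvature string (same chart, step, basin, Wilson embedding,
`betaOf`, `b₀`, `κ`; unchanged on pure-curvature strings). Hence the typed crux constrains ONLY the plaquette field
`tr F²`; the `n`-point functions of all other local gauge-invariant fields — which `IsYangMillsFor` needs downstream —
are not constrained by `Nonempty (BalabanBanachStep G r M)`. Repair for the planner: pin `c` (e.g. `c g s = 1`).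
-/

namespace Summit.QuantumFields.YangMills.Theorems.BalabanStepParabolic.Negative

open scoped SchwartzMap
open MeasureTheory Filter Topology
open Literature.MathematicalPhysics.QuantumFieldTheory Literature.MathematicalPhysics.AQFT
open Literature.MathematicalPhysics.QuantumLattice

noncomputable section

variable {G : Type} [Group G] [TopologicalSpace G] [IsTopologicalGroup G] [CompactSpace G]
  [MeasurableSpace G] [BorelSpace G] (r : LatticeRep G)

open Classical in
/-- Normalisations killing every species but the curvature. -/
def cInd : YMSpecies G → ℝ := fun s => if s = r.curvature then 1 else 0

/-- `cInd` is `1` on the curvature species. [folklore] -/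
@[simp] theorem cInd_curvature : cInd r r.curvature = 1 := by simp [cInd]

/-- `cInd` vanishes off the curvature species. [folklore] -/
theorem cInd_of_ne {s : YMSpecies G} (hs : s ≠ r.curvature) : cInd r s = 0 := by simp [cInd, hs]

open Classical in
/-- With `cInd`, a species string containing a non-curvature species has vanishing centred
Wilson `n`-point functions (a zero factor). [folklore] -/
theorem wilsonCentredSchwinger_cInd_of_exists (β : ℝ) (L n : ℕ) {σ : Fin n → YMSpecies G}
    (h : ∃ i, σ i ≠ r.curvature) (f : Fin n → 𝓢(EuclideanSpace ℝ (Fin 4), ℝ)) :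
    wilsonCentredSchwinger r.ρ β L (cInd r) n σ f = 0 := by
  obtain ⟨i, hi⟩ := h
  unfold wilsonCentredSchwinger
  have hzero : ∀ U : GaugeConfig 4 (2 * L + 1) G,
      (∏ j, smearedLatticeField (σ j).F (Literature.Probability.LatticeModels.box 4 L) 1
        (cInd r (σ j)) (wilsonTorusMean r.ρ β L (σ j).F) (f j) (torusLift (2 * L + 1) U)) = 0 :=
    fun U => Finset.prod_eq_zero (Finset.mem_univ i) (by simp [smearedLatticeField, cInd, hi])
  simp_rw [hzero, integral_zero]

open Classical in
/-- With `cInd` the centred Wilson `n`-point function is the pure-curvature one or zero. [folklore] -/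
theorem wilsonCentredSchwinger_cInd (β : ℝ) (L n : ℕ) (σ : Fin n → YMSpecies G)
    (f : Fin n → 𝓢(EuclideanSpace ℝ (Fin 4), ℝ)) :
    wilsonCentredSchwinger r.ρ β L (cInd r) n σ f =
      if (∀ i, σ i = r.curvature) then
        wilsonCentredSchwinger r.ρ β L (fun _ => 1) n (fun _ => r.curvature) f else 0 := by
  by_cases h : ∀ i, σ i = r.curvature
  · rw [if_pos h]
    have hσ : σ = fun _ => r.curvature := funext h
    subst hσ
    unfold wilsonCentredSchwinger
    simp
  · rw [if_neg h]
    obtain ⟨i, hi⟩ := not_forall.1 h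
    unfold wilsonCentredSchwinger
    have hzero : ∀ U : GaugeConfig 4 (2 * L + 1) G,
        (∏ j, smearedLatticeField (σ j).F (Literature.Probability.LatticeModels.box 4 L) 1
          (cInd r (σ j)) (wilsonTorusMean r.ρ β L (σ j).F) (f j) (torusLift (2 * L + 1) U)) = 0 :=
      fun U => Finset.prod_eq_zero (Finset.mem_univ i) (by simp [smearedLatticeField, cInd, hi])
    simp_rw [hzero, integral_zero]

variable {r} {M : ℕ} (S : BalabanBanachStep G r M)

open Classical in
/-- **The curvature-only reduction of an inhabitant**: same chart, step, basin, Wilson embedding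
and `betaOf`; normalisations `cInd` (zero off the curvature species); realisation functional
equal to `S.expect` on pure-curvature strings and ZERO on every other string. -/
def curvatureOnly : BalabanBanachStep G r M where
  E := S.E
  φ := S.φ
  Ψ := S.Ψ
  A := S.A
  b := S.b
  θ := S.θ
  C := S.C
  δ := S.δ
  b_pos := S.b_pos
  θ_nonneg := S.θ_nonneg
  θ_lt_one := S.θ_lt_one
  C_pos := S.C_pos
  δ_pos := S.δ_pos
  norm_A_le := S.norm_A_le
  remainder := S.remainder
  lipschitz_fibre := S.lipschitz_fibre
  lipschitz_base := S.lipschitz_base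
  b₀ := S.b₀
  b_eq := S.b_eq
  R := S.R
  δ_le_R := S.δ_le_R
  θ' := S.θ'
  θ'_nonneg := S.θ'_nonneg
  θ'_lt_one := S.θ'_lt_one
  contraction := S.contraction
  remainder_basin := S.remainder_basin
  yW := S.yW
  g₀ := S.g₀
  g₀_pos := S.g₀_pos
  continuousOn_yW := S.continuousOn_yW
  norm_yW_le := S.norm_yW_le
  betaOf := S.betaOf
  strictAntiOn_betaOf := S.strictAntiOn_betaOf
  continuousOn_betaOf := S.continuousOn_betaOf
  κ := S.κ
  κ_pos := S.κ_pos
  K := S.K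
  betaOf_sub_le := S.betaOf_sub_le
  c _ := cInd r
  c_curvature _ := cInd_curvature r
  expect p T n σ f := if ∀ i, σ i = r.curvature then S.expect p T n σ f else 0
  expect_step g y hg hy T n σ f := by
    by_cases h : ∀ i, σ i = r.curvature
    · simp only [h, implies_true, ↓reduceIte]; exact S.expect_step g y hg hy T n σ f
    · simp only [h, ↓reduceIte]
  expect_wilson g hg L n σ f := by
    by_cases h : ∀ i, σ i = r.curvature
    · simp only [h, implies_true, ↓reduceIte]
      rw [S.expect_wilson g hg L n σ f]
      exact wilsonCentredSchwinger_congr_c' r.ρ _ L (fun i => by rw [h i, S.c_curvature, cInd_curvature]) f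
    · simp only [h, ↓reduceIte]
      exact (wilsonCentredSchwinger_cInd_of_exists r _ L n (not_forall.1 h) f).symm
  continuousOn_expect T n σ f hf := by
    by_cases h : ∀ i, σ i = r.curvature
    · simp only [h, implies_true, ↓reduceIte]; exact S.continuousOn_expect T n σ f hf
    · simp only [h, ↓reduceIte]; exact continuousOn_const
where
  /-- dependence on `c` only through `c ∘ σ` -/
  wilsonCentredSchwinger_congr_c' {N : ℕ} (ρ : G →* Matrix (Fin N) (Fin N) ℂ) (β : ℝ) (L : ℕ)
      {c c' : YMSpecies G → ℝ} {n : ℕ} {σ : Fin n → YMSpecies G}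
      (h : ∀ i, c (σ i) = c' (σ i)) (f : Fin n → 𝓢(EuclideanSpace ℝ (Fin 4), ℝ)) :
      wilsonCentredSchwinger ρ β L c n σ f = wilsonCentredSchwinger ρ β L c' n σ f := by
    unfold wilsonCentredSchwinger; simp_rw [h]

open Classical in
/-- **Species generality is illusory .** If `BalabanBanachStep G r M` is inhabited, it is
inhabited by a structure whose normalisations VANISH on every non-curvature species and whose
realisation functional is ZERO on every species string that is not pure curvature (same chart,
step, Wilson embedding, `betaOf`, and the same values on pure-curvature strings). So the only
observable content the typed crux can force concerns the plaquette field `tr F²`; the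
"`n`-point functions of ALL local gauge-invariant fields" needed downstream by `IsYangMillsFor` are
not constrained. PLANNER: pin `c` (e.g. `c g s = 1` for all `s`, or a positivity/normalisation
condition per species) if the crux is to feed `ContinuumLimitOnTrajectory`. [folklore] -/
theorem exists_curvatureOnly :
    ∃ S' : BalabanBanachStep G r M,
      (∀ (g : ℝ) (s : YMSpecies G), s ≠ r.curvature → S'.c g s = 0) ∧
      (∀ (p : ℝ × S'.E) (T n : ℕ) (σ : Fin n → YMSpecies G)
        (f : Fin n → 𝓢(EuclideanSpace ℝ (Fin 4), ℝ)), (∃ i, σ i ≠ r.curvature) → S'.expect p T n σ f = 0) ∧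
      S'.E = S.E ∧ S'.b₀ = S.b₀ ∧ S'.κ = S.κ := by
  refine ⟨curvatureOnly S, fun g s hs => cInd_of_ne r hs, fun p T n σ f hσ => ?_, rfl, rfl, rfl⟩
  obtain ⟨i, hi⟩ := hσ
  have h : ¬ ∀ i, σ i = r.curvature := fun h => hi (h i)
  show (if ∀ i, σ i = r.curvature then S.expect p T n σ f else 0) = 0
  rw [if_neg h]

end

end Summit.QuantumFields.YangMills.Theorems.BalabanStepParabolic.Negative
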